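import Summits.CriticalPhenomena.PercolationContinuityZ3.Theorems.PercNearOneGluingNoHeavyLowerTailSunflowerLinkedCurrencyVoluntary
import HarnessLib

/-!
# `NoHeavyLowerTail` (crux stmt-CriticalPhenomena-4575), abstract sunflower cubic: (RES0′) for EVERY number of petals and
# EVERY coin triple on the face `κ = 1` (`α₀₁ = α₁₁`) of the floor simplex

Support file (seat `prim-ineq-prove-1` gen 59; `--supports stmt-CriticalPhenomena-4575`).  No `sorry`, no named facts.
Memo: run/shared/lean/prim/prim-ineq-prove-1/FINDING-KAPPAONE-prove1-g59.md.

SETTING (the two-linked-systems model of the leaf-leaf lemma's `z₂`-slice, `…SunflowerLinkedCurrency`,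
`…SunflowerVertexCertificate`): coins `τ, σ, s`, floors `α₀₀ ≤ α₀₁ ≤ α₁₁`, `p = τ(1−σ)`, `q = s(1−τ)`, petals
`(y, k, g, h)` with `α₀₀ ≤ y ≤ k`, `α₀₁ ≤ g ≤ min(k, h)`, values `G = c₀ + p((1−s)y + sk) + q((1−σ)g + σh)`,
floor value `g* = G(floor)`, full value `a = c₀ + p + q`; Lemma-A budgets on the cells and on the two faces
`Ȳ = (1−s)y + sk`, `H = (1−σ)g + σh`.  CLAIM (RES0′): `∏_j G_j ≤ (g*)^(n−1)·a`.

**THEOREM `res0_kappa_one`.**  If the two upper floors coincide (`α₀₁ = α₁₁ = β`, i.e. `κ = α₀₁/α₁₁ = 1`), then (RES0′)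
holds for every number of petals, every `0 < τ < 1`, `0 < σ < 1`, `0 < s ≤ 1`, every `0 < α₀₀ ≤ β`, every
`c₀ ≥ τσ + (1−τ)(1−s)α₀₀` (the leaf-leaf constant), from the `Ȳ`-face budget and the `h`-cell budget ALONE (no caps
`k, h, β ≤ 1`, no link `y ≤ k`, no other budget).  With `res0_equal_floors` (all three floors equal, `…SunflowerChainCertificateExplicit`)
this is the first stratum of the floor simplex on which (RES0′) is a theorem for ALL coins; it contains the F2 direction
(`H`-hub plus a cloud of cheap-`y` dwarfs `(α₀₁,α₀₁,α₀₁,α₁₁)`, tight as `s → 1`) that every cell-only certificate misses.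

PROOF.  Instantiate gen 54's kernel lemma `freeH_kappa_one` (the linked two-currency lemma with voluntary `h`-excess):
`ε_Y = p b_Ȳ/g*`, `ε_g = q(1−σ)β/g*`, `ε_h = qσβ/g*`, `x_j = Ȳ_j/b_Ȳ`, `m_j = q(1−σ)(g_j − β)/g*`, `r_j = h_j/β`,
`τ' = p/(1−τσ)`, `ρ = τ/(1−τ)`, `X = 1/b_Ȳ`, `R = 1/β`.  Its caps become: `ε_Y ≤ τ'` ⟺
`(1−τ)(1−s)·s(β−α₀₀) ≤ τσ + s(1−τ)(1−s)(β−α₀₀)` [uses `c₀ ≥ τσ + (1−τ)(1−s)α₀₀`]; `ε_g + ε_h ≤ 1 − τ'` ⟺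
`qβp ≤ (1−τ)(c₀ + p b_Ȳ)`; the link constant identity `ρ(1−τ')ε_g = τ'(ε_g+ε_h)` holds exactly BECAUSE `b_H = β`
(this is where `κ = 1` enters; for `κ < 1` the needed cap `ε_Y ≤ ε_k/(ε_k+ε_H)` is false in the model, memo g54 §9);
`ε_Y X ε_h ≤ c ε_g` ⟺ `τσ ≤ c₀`; the links `ρ m_j ≤ ε_Y(x_j − 1)` ⟸ `k_j ≥ g_j`, `ε_g + m_j ≤ ε_g r_j` ⟸ `h_j ≥ g_j`.
-/

noncomputable section

namespace Summit.CriticalPhenomena.PercolationContinuityZ3.Theorems.SunflowerPartition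

namespace SafeCalc

namespace LinkedCurrency

open Finset

variable {κ : Type*}

/-- **(RES0′) on the face `κ = 1` (`α₀₁ = α₁₁ = β`), every number of petals, every coin triple.**
Coins `0 < τ < 1`, `0 < σ < 1`, `0 < s ≤ 1`; floors `0 < α₀₀ ≤ β`; constant `c₀ ≥ τσ + (1−τ)(1−s)α₀₀`;
petals with `α₀₀ ≤ y_j`, `β ≤ g_j ≤ min(k_j, h_j)` (the link `y ≤ k` and the caps `k, h, β ≤ 1` are not needed);
the `Ȳ`-face budget
`∏((1−s)y_j + sk_j) ≤ ((1−s)α₀₀ + sβ)^(|S|−1)` and the `h`-cell budget `∏ h_j ≤ β^(|S|−1)`.  Then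
`∏_j (c₀ + τ(1−σ)Ȳ_j + s(1−τ)H_j) ≤ (g*)^(|S|−1)·(c₀ + τ(1−σ) + s(1−τ))`.  From `freeH_kappa_one`. [this work] -/
theorem res0_kappa_one [DecidableEq κ] {τ σ s α00 β c0 : ℝ} (hτ0 : 0 < τ) (hτ1 : τ < 1) (hσ0 : 0 < σ)
    (hσ1 : σ < 1) (hs0 : 0 < s) (hs1 : s ≤ 1) (hα0 : 0 < α00) (hαβ : α00 ≤ β)
    (hc0 : τ * σ + (1 - τ) * (1 - s) * α00 ≤ c0)
    (S : Finset κ) (hS : S.Nonempty) (y k gc h : κ → ℝ)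
    (hy : ∀ j ∈ S, α00 ≤ y j) (hg : ∀ j ∈ S, β ≤ gc j)
    (hgk : ∀ j ∈ S, gc j ≤ k j) (hgh : ∀ j ∈ S, gc j ≤ h j)
    (hBY : ∏ j ∈ S, ((1 - s) * y j + s * k j) ≤ ((1 - s) * α00 + s * β) ^ (S.card - 1))
    (hBh : ∏ j ∈ S, h j ≤ β ^ (S.card - 1)) :
    ∏ j ∈ S, (c0 + τ * (1 - σ) * ((1 - s) * y j + s * k j) + s * (1 - τ) * ((1 - σ) * gc j + σ * h j)) ≤
      (c0 + τ * (1 - σ) * ((1 - s) * α00 + s * β) + s * (1 - τ) * ((1 - σ) * β + σ * β)) ^ (S.card - 1) *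
        (c0 + τ * (1 - σ) + s * (1 - τ)) := by
  have hτ1' : 0 < 1 - τ := sub_pos.2 hτ1
  have hσ1' : 0 < 1 - σ := sub_pos.2 hσ1
  have hs1' : 0 ≤ 1 - s := sub_nonneg.2 hs1
  have hβ0 : 0 < β := lt_of_lt_of_le hα0 hαβ
  have hτσ : 0 < 1 - τ * σ := by nlinarith
  set p := τ * (1 - σ) with hp
  set q := s * (1 - τ) with hq
  set bY := (1 - s) * α00 + s * β with hbY
  set g := c0 + τ * (1 - σ) * ((1 - s) * α00 + s * β) + s * (1 - τ) * ((1 - σ) * β + σ * β) with hgdef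
  have hp0 : 0 < p := mul_pos hτ0 hσ1'
  have hq0 : 0 < q := mul_pos hs0 hτ1'
  have hbY0 : 0 < bY := by
    rw [hbY]; exact add_pos_of_nonneg_of_pos (mul_nonneg hs1' hα0.le) (mul_pos hs0 hβ0)
  have hc0' : 0 ≤ c0 := le_trans (by positivity) hc0
  have hgeq : g = c0 + p * bY + q * β := by rw [hgdef, hp, hq, hbY]; ring
  have hgpos : 0 < g := by rw [hgeq]; nlinarith [mul_pos hp0 hbY0, mul_pos hq0 hβ0]
  have hgne : g ≠ 0 := hgpos.ne'
  -- two polynomial facts (the caps), proved before the context grows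
  have hpoly1 : bY * (1 - τ * σ) ≤ g := by
    rw [hgeq, hp, hq, hbY]
    nlinarith [mul_nonneg (mul_nonneg hτ1'.le hs1') (mul_nonneg hs0.le (sub_nonneg.2 hαβ)),
      mul_nonneg hτ0.le hσ0.le, mul_nonneg (mul_nonneg hτ0.le hσ1'.le) (mul_nonneg hs1' hα0.le)]
  have hpoly2 : q * β * (1 - τ * σ) ≤ (1 - τ) * g := by
    rw [hgeq, hp, hq, hbY]
    nlinarith [mul_nonneg hτ1'.le hc0', mul_nonneg (mul_nonneg hτ1'.le (mul_nonneg hτ0.le hσ1'.le)) (mul_nonneg hs1' hα0.le),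
      mul_nonneg (mul_nonneg hτ1'.le (mul_nonneg hτ0.le hσ1'.le)) (mul_nonneg hs0.le hβ0.le), hs1]
  have hpoly3 : τ * (1 - σ) < 1 - τ * σ := by
    have e : τ * (1 - σ) = τ - τ * σ := by ring
    rw [e]; linarith only [hτ1]
  -- the data of `freeH_kappa_one`
  obtain ⟨τ', hτ'd⟩ : ∃ e : ℝ, e = p / (1 - τ * σ) := ⟨_, rfl⟩
  obtain ⟨εY, hεYd⟩ : ∃ e : ℝ, e = p * bY / g := ⟨_, rfl⟩
  obtain ⟨εg, hεgd⟩ : ∃ e : ℝ, e = q * (1 - σ) * β / g := ⟨_, rfl⟩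
  obtain ⟨εh, hεhd⟩ : ∃ e : ℝ, e = q * σ * β / g := ⟨_, rfl⟩
  obtain ⟨ρ, hρd⟩ : ∃ e : ℝ, e = τ / (1 - τ) := ⟨_, rfl⟩
  obtain ⟨X, hXd⟩ : ∃ e : ℝ, e = 1 / bY := ⟨_, rfl⟩
  obtain ⟨R, hRd⟩ : ∃ e : ℝ, e = 1 / β := ⟨_, rfl⟩
  obtain ⟨x, hxd⟩ : ∃ f : κ → ℝ, f = fun j => ((1 - s) * y j + s * k j) / bY := ⟨_, rfl⟩
  obtain ⟨m, hmd⟩ : ∃ f : κ → ℝ, f = fun j => q * (1 - σ) * (gc j - β) / g := ⟨_, rfl⟩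
  obtain ⟨r, hrd⟩ : ∃ f : κ → ℝ, f = fun j => h j / β := ⟨_, rfl⟩
  have hτ'0 : 0 < τ' := by rw [hτ'd]; exact div_pos hp0 hτσ
  have hτ'1 : τ' < 1 := by
    rw [hτ'd, div_lt_one hτσ, hp]; exact hpoly3
  have hεY0 : 0 < εY := by rw [hεYd]; exact div_pos (mul_pos hp0 hbY0) hgpos
  have hεg0 : 0 < εg := by rw [hεgd]; exact div_pos (mul_pos (mul_pos hq0 hσ1') hβ0) hgpos
  have hεh0 : 0 < εh := by rw [hεhd]; exact div_pos (mul_pos (mul_pos hq0 hσ0) hβ0) hgpos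
  have hρ0 : 0 < ρ := by rw [hρd]; exact div_pos hτ0 hτ1'
  -- cap 1: εY ≤ τ'  ⟺  bY (1 - τσ) ≤ g
  have hcap1 : εY ≤ τ' := by
    rw [hεYd, hτ'd, div_le_div_iff₀ hgpos hτσ]
    calc p * bY * (1 - τ * σ) = p * (bY * (1 - τ * σ)) := by ring
      _ ≤ p * g := mul_le_mul_of_nonneg_left hpoly1 hp0.le
  -- cap 2: εg + εh ≤ 1 - τ'  ⟺  q β (1 - τσ) ≤ (1 - τ) g
  have hcap2 : εg + εh ≤ 1 - τ' := by
    have h1τ' : 1 - τ' = (1 - τ) / (1 - τ * σ) := by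
      rw [hτ'd, hp]; field_simp; ring
    rw [h1τ', hεgd, hεhd, ← add_div, div_le_div_iff₀ hgpos hτσ]
    calc (q * (1 - σ) * β + q * σ * β) * (1 - τ * σ) = q * β * (1 - τ * σ) := by ring
      _ ≤ (1 - τ) * g := hpoly2
  -- the link-constant identity (uses b_H = β, i.e. κ = 1)
  have hρeq : ρ * ((1 - τ') * εg) = τ' * (εg + εh) := by
    rw [hρd, hτ'd, hεgd, hεhd, hp, hq]
    field_simp
    ring
  -- the c₀ ≥ τσ relation
  have hrel : εY * X * εh ≤ (1 - εY - εg - εh) * εg := by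
    have hc : 1 - εY - εg - εh = c0 / g := by
      rw [hεYd, hεgd, hεhd]; field_simp; rw [hgeq]; ring
    rw [hc, hεYd, hXd, hεhd, hεgd]
    have hτσc : τ * σ ≤ c0 :=
      le_trans (le_add_of_nonneg_right (mul_nonneg (mul_nonneg hτ1'.le hs1') hα0.le)) hc0
    have e1 : p * bY / g * (1 / bY) * (q * σ * β / g) = (τ * σ) * ((1 - σ) * q * β) / (g * g) := by
      rw [hp]; field_simp
    have e2 : c0 / g * (q * (1 - σ) * β / g) = c0 * ((1 - σ) * q * β) / (g * g) := by
      field_simp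
    rw [e1, e2]
    exact div_le_div_of_nonneg_right (mul_le_mul_of_nonneg_right hτσc (by positivity)) (by positivity)
  -- petal hypotheses
  have hx1 : ∀ j ∈ S, 1 ≤ x j := fun j hj => by
    rw [hxd]; dsimp only; rw [le_div_iff₀ hbY0, one_mul, hbY]
    exact add_le_add (mul_le_mul_of_nonneg_left (hy j hj) hs1')
      (mul_le_mul_of_nonneg_left ((hg j hj).trans (hgk j hj)) hs0.le)
  have hm0 : ∀ j ∈ S, 0 ≤ m j := fun j hj => by
    rw [hmd]
    exact div_nonneg (mul_nonneg (mul_nonneg hq0.le hσ1'.le) (sub_nonneg.2 (hg j hj))) hgpos.le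
  have hlink : ∀ j ∈ S, ρ * m j ≤ εY * (x j - 1) := fun j hj => by
    have hyj := hy j hj; have hgkj := hgk j hj
    rw [hρd, hmd, hεYd, hxd]; dsimp only
    rw [show p * bY / g * (((1 - s) * y j + s * k j) / bY - 1) = p * ((1 - s) * (y j - α00) + s * (k j - β)) / g by
      rw [hbY]; field_simp; ring]
    rw [show τ / (1 - τ) * (q * (1 - σ) * (gc j - β) / g) = p * (s * (gc j - β)) / g by
      rw [hp, hq]; field_simp]
    have h1 : 0 ≤ (1 - s) * (y j - α00) := mul_nonneg hs1' (sub_nonneg.2 hyj)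
    have h2 : s * (gc j - β) ≤ s * (k j - β) := mul_le_mul_of_nonneg_left (by linarith only [hgkj]) hs0.le
    exact div_le_div_of_nonneg_right (mul_le_mul_of_nonneg_left (by linarith only [h1, h2]) hp0.le) hgpos.le
  have hr : ∀ j ∈ S, εg + m j ≤ εg * r j ∧ 1 ≤ r j := fun j hj => by
    have hghj := hgh j hj; have hgj := hg j hj
    refine ⟨?_, ?_⟩
    · rw [hεgd, hmd, hrd]; dsimp only
      rw [show q * (1 - σ) * β / g + q * (1 - σ) * (gc j - β) / g = q * (1 - σ) * gc j / g by ring,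
        show q * (1 - σ) * β / g * (h j / β) = q * (1 - σ) * h j / g by field_simp]
      exact div_le_div_of_nonneg_right (mul_le_mul_of_nonneg_left hghj (mul_nonneg hq0.le hσ1'.le)) hgpos.le
    · rw [hrd]; dsimp only; rw [le_div_iff₀ hβ0, one_mul]; exact hgj.trans hghj
  -- budgets in usage form
  have hcard : 1 ≤ S.card := Finset.card_pos.2 hS
  have hBx : ∏ j ∈ S, x j ≤ X := by
    rw [hxd, hXd]; dsimp only
    rw [prod_div_distrib, prod_const, div_le_div_iff₀ (by positivity) hbY0, one_mul,
      show bY ^ S.card = bY ^ (S.card - 1) * bY by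
        conv_lhs => rw [show S.card = (S.card - 1) + 1 by omega, pow_succ]]
    exact mul_le_mul_of_nonneg_right hBY hbY0.le
  have hBr : ∏ j ∈ S, r j ≤ R := by
    rw [hrd, hRd]; dsimp only
    rw [prod_div_distrib, prod_const, div_le_div_iff₀ (by positivity) hβ0, one_mul,
      show β ^ S.card = β ^ (S.card - 1) * β by
        conv_lhs => rw [show S.card = (S.card - 1) + 1 by omega, pow_succ]]
    exact mul_le_mul_of_nonneg_right hBh hβ0.le
  have key := freeH_kappa_one S x m r hτ'0 hτ'1 hεY0 hcap1 hεg0 hεh0 hcap2 hρ0 hρeq hrel hx1 hm0 hlink hr hBx hBr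
  -- identify the factors and the right-hand side
  have hfac : ∀ j ∈ S, c0 + τ * (1 - σ) * ((1 - s) * y j + s * k j) + s * (1 - τ) * ((1 - σ) * gc j + σ * h j) =
      g * (1 + εY * (x j - 1) + m j + εh * (r j - 1)) := by
    intro j _
    have e1 : g * (εY * (x j - 1)) = p * ((1 - s) * y j + s * k j) - p * bY := by
      rw [hεYd, hxd]; dsimp only; field_simp
    have e2 : g * m j = q * (1 - σ) * (gc j - β) := by
      rw [hmd]; dsimp only; field_simp
    have e3 : g * (εh * (r j - 1)) = q * σ * h j - q * σ * β := by
      rw [hεhd, hrd]; dsimp only; field_simp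
    calc c0 + τ * (1 - σ) * ((1 - s) * y j + s * k j) + s * (1 - τ) * ((1 - σ) * gc j + σ * h j)
        = g + (p * ((1 - s) * y j + s * k j) - p * bY) + q * (1 - σ) * (gc j - β) + (q * σ * h j - q * σ * β) := by
          rw [hgeq, hp, hq]; ring
      _ = g * (1 + εY * (x j - 1) + m j + εh * (r j - 1)) := by rw [← e1, ← e2, ← e3]; ring
  have hrhs : g * (1 + εY * (X - 1) + εg * (R - 1) + εh * (R - 1)) = c0 + τ * (1 - σ) + s * (1 - τ) := by
    have e1 : g * (εY * (X - 1)) = p - p * bY := by rw [hεYd, hXd]; field_simp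
    have e2 : g * (εg * (R - 1)) = q * (1 - σ) - q * (1 - σ) * β := by rw [hεgd, hRd]; field_simp
    have e3 : g * (εh * (R - 1)) = q * σ - q * σ * β := by rw [hεhd, hRd]; field_simp
    calc g * (1 + εY * (X - 1) + εg * (R - 1) + εh * (R - 1))
        = g + g * (εY * (X - 1)) + g * (εg * (R - 1)) + g * (εh * (R - 1)) := by ring
      _ = c0 + τ * (1 - σ) + s * (1 - τ) := by rw [e1, e2, e3, hgeq, hp, hq]; ring
  rw [prod_congr rfl hfac, prod_const_mul', ← hrhs,
    show g ^ S.card = g ^ (S.card - 1) * g by conv_lhs => rw [show S.card = (S.card - 1) + 1 by omega, pow_succ],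
    mul_assoc]
  exact mul_le_mul_of_nonneg_left (mul_le_mul_of_nonneg_left key hgpos.le) (by positivity)

end LinkedCurrency

end SafeCalc

end Summit.CriticalPhenomena.PercolationContinuityZ3.Theorems.SunflowerPartition
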